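import Summits.BirchSwinnertonDyer.BirchSwinnertonDyer.Theorems.GoldfeldAllTwistsTwoConverseTwinAdditiveSplitPrimeTwistSelmer
import HarnessLib

set_option linter.dupNamespace false -- namespace `…BirchSwinnertonDyer.BirchSwinnertonDyer…` is the cell's (D-0017 nested layout)
set_option autoImplicit false

/-!
# Twin″ (item 19140), 7-INERT half: the SPLIT SYMBOL at `ℓ` — one quadratic symbol
# `σ(ℓ) = [(−21 + √−7)/2 mod 𝔩]` decides the `ℓ`-classes of the `2`-isogeny Selmer sets of
# `49a1^{(ℓ)}`, `49a1^{(−ℓ)}` and `49a1^{(aℓ)}` for a prime `ℓ` split in `ℚ(√−7)` (auxiliary-prime road)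

Cell `bsd-goldfeld`, seat `bsd-goldfeld-s1p-c301` (prover, gen 13); `--supports stmt-BirchSwinnertonDyer-19140`
(twin″ `Theses.GoldfeldAllTwistsTwoConverse.BSDTwoCMSevenAdditiveRankOne`) as a HELPER for the prime family
`𝒮 = {49a1^{(−ℓ)} : ℓ ≡ 5 (mod 8) prime, (ℓ/7) = +1}` of the 7-INERT half of the additive cell
(`(−ℓ/7) = −1`; the family of part VIII `…TwinAdditiveSplitPrimeTwistSelmer`, where `#S ≤ 4`, `#S' ≤ 2` are
proved but the Selmer SET varies with `ℓ`). Theses-free; theorems only; nothing about `L`-values or BSD.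

MATHEMATICS (elementary; model `E_M : y² = x³ + 21M x² + 112M² x = C₀ • 49a1^{(M)}` of part II,
`S(M) = twoIsogenySelmerGroup (21M) (112M²)`, `S'(M) = twoIsogenySelmerGroup (−42M) (−7M²)`).
Fix a prime `ℓ ∉ {2, 7}` and `s, t ∈ 𝔽_ℓ` with `s² = −7`, `t² = 7` (both exist iff `ℓ ≡ 1 (mod 4)` and
`(ℓ/7) = +1`). For `M = ℓ m₀` with `ℓ ∤ m₀` the classes `D = ℓ d₀` of `S(M)` (`d₀ e₀ = 112 m₀²`) and of
`S'(M)` (`d₀ e₀ = −7 m₀²`) have homogeneous spaces `w² = ℓ (d₀ u⁴ + 21 m₀ u²z² + e₀ z⁴)` resp.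
`w² = ℓ (d₀ u⁴ − 42 m₀ u²z² + e₀ z⁴)`; such a space has a `ℚ_ℓ`-point only if the quartic has a root
modulo `ℓ` (§2, `not_isSoluble_padic_of_forall_quartic_ne_zero`), and completing the square shows
(§3) that a root exists only if `2(s − 21)·m₀·e₀` — resp. `(21 + 8t)·m₀·e₀` — is a square mod `ℓ`.
The two symbols COINCIDE: **`(t + s(3t + 8))² = 2(21 + 8t)(s − 21)`** whenever `s² = −7`, `t² = 7`
(§1, `sq_symbol_identity`; over `ℚ(√7, √−7)`: `ε·(−21 + √−7)/2 = □` for the unit `ε = 21 + 8√7 = (8 + 3√7)²/…`),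
so ONE symbol `σ(ℓ) := [2(s − 21) ∈ 𝔽_ℓ²]` governs both. Consequences (§5), writing `a` for an
auxiliary prime with `(a/ℓ) = −1`:
* `σ(ℓ) = −1` ⇒ `ℓ, 7ℓ ∉ S(ℓ)`, `ℓ, −7ℓ ∉ S'(ℓ)` (the positive partner twist `49a1^{(ℓ)}`), and
  `ℓ, 7ℓ ∉ S(−ℓ)`;
* `σ(ℓ) = +1` ⇒ `ℓ, 7ℓ ∉ S(aℓ)`, `ℓ, −7ℓ ∉ S'(aℓ)` (the partner `49a1^{(aℓ)}`), and, for `ℓ ≡ 5 (mod 8)`,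
  `2ℓ, 14ℓ ∉ S(−ℓ)`.
This is the `ℓ`-adic half of the COMPLEMENTARITY LAW observed numerically by this seat (kit job j287842,
memo `HOME/INERT7-AUXPRIME-HORIZON.md`): for `ℓ ≡ 5 (mod 8)` split and `a ≡ 1 (mod 8)`, `(a/7) = (a/ℓ) = −1`,
exactly one of `Sel₂(49a1^{(ℓ)})`, `Sel₂(49a1^{(aℓ)})` is minimal, according to `σ(ℓ)`. The classes NOT
divisible by `ℓ` (killed at `2`, `7`, `a`, `∞`) are not treated here.

HONEST FRAMING: local algebra at one prime; no Selmer set is computed in full, no rank is bounded, no case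
of twin″ or of K12₂″ is decided, and BSD is not proved by any of this. The memo explains why the road it
serves (genus transfer from a 2-minimal partner over `ℚ(√−aℓ)`) reaches only the FIRST of the two halvings
of the genus point that twin″ demands on `𝒮` (`ι = 0`, `σ = 1` in the index law of part XIV).

References: Silverman, *AEC* (2009), X.4.9 [SilvermanAEC2009]; Zywina, arXiv:2502.01957, Lemma 3.1 [Zywina2025]
(chart reduction `exists_padicInt_of_isSoluble`).
-/

noncomputable section

open scoped Classical

open WeierstrassCurve Literature.NumberTheory.EllipticCurves
open Literature.NumberTheory.EllipticCurves.Zywina2025 (exists_padicInt_of_isSoluble)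

namespace Summit.BirchSwinnertonDyer.BirchSwinnertonDyer.Theorems.GoldfeldGoodTwists

/-! ## §1. The symbol identity -/

/-- **The split-symbol identity.** In any commutative ring, `s² = −7` and `t² = 7` imply
`(t + s(3t + 8))² = 2(21 + 8t)(s − 21)`; over `ℚ(√7, √−7)` it says that `(−21 + √−7)/2` times the unit
`21 + 8√7` is a square. [folklore] -/
theorem sq_symbol_identity {R : Type*} [CommRing R] {s t : R} (hs : s ^ 2 = -7) (ht : t ^ 2 = 7) :
    (t + s * (3 * t + 8)) ^ 2 = 2 * (21 + 8 * t) * (s - 21) := by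
  linear_combination (9 * t ^ 2 + 48 * t + 64) * hs + (6 * s - 62) * ht

section Field

variable {F : Type*} [Field F]

/-- In a field: if `u ≠ 0` and `u·v` is a square, then `x·u` a square implies `x·v` a square. [folklore] -/
theorem isSquare_mul_of_isSquare_mul {u v : F} (hu : u ≠ 0) (huv : IsSquare (u * v)) {x : F}
    (hx : IsSquare (x * u)) : IsSquare (x * v) := by
  obtain ⟨r, hr⟩ := huv
  obtain ⟨y, hy⟩ := hx
  refine ⟨y * r / u, ?_⟩
  have key : x * v * (u * u) = (y * r) * (y * r) := by
    linear_combination (u * v) * hy + (y * y) * hr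
  rw [div_mul_div_comm, eq_div_iff (mul_ne_zero hu hu)]
  exact key

/-- In a field: if `u v ≠ 0` and `u·v` is a square, then `x·u` is a square iff `x·v` is. [folklore] -/
theorem isSquare_mul_iff_of_isSquare_mul {u v : F} (hu : u ≠ 0) (hv : v ≠ 0) (huv : IsSquare (u * v))
    (x : F) : IsSquare (x * u) ↔ IsSquare (x * v) :=
  ⟨isSquare_mul_of_isSquare_mul hu huv, isSquare_mul_of_isSquare_mul hv (by rwa [mul_comm])⟩

variable {s t : F}

/-- `s² = −7`, `t² = 7`, `7 ≠ 0` ⇒ `−1 = (st/7)²` is a square. [folklore] -/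
theorem isSquare_neg_one_of_sq (hs : s ^ 2 = -7) (ht : t ^ 2 = 7) (h7 : (7 : F) ≠ 0) :
    IsSquare (-1 : F) := by
  have h : s ^ 2 * t ^ 2 = -49 := by rw [hs, ht]; norm_num
  refine ⟨s * t / 7, ?_⟩
  rw [div_mul_div_comm, eq_div_iff (mul_ne_zero h7 h7)]
  linear_combination -h

/-- `2, 7 ≠ 0` and `s² = −7` ⇒ `s − 21 ≠ 0` and `s + 21 ≠ 0` (else `448 = 2⁶·7 = 0`). [folklore] -/
theorem sub_ne_zero_and_add_ne_zero_of_sq (hs : s ^ 2 = -7) (h2 : (2 : F) ≠ 0) (h7 : (7 : F) ≠ 0) :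
    s - 21 ≠ 0 ∧ s + 21 ≠ 0 := by
  have h448 : (448 : F) ≠ 0 := by
    have : (448 : F) = 2 ^ 6 * 7 := by norm_num
    rw [this]; exact mul_ne_zero (pow_ne_zero _ h2) h7
  have hprod : (s - 21) * (s + 21) = -448 := by linear_combination hs
  constructor
  · intro h
    rw [h, zero_mul] at hprod
    exact h448 (by linear_combination hprod)
  · intro h
    rw [h, mul_zero] at hprod
    exact h448 (by linear_combination hprod)

/-- `2, 7 ≠ 0` and `t² = 7` ⇒ `21 + 8t ≠ 0` and `21 − 8t ≠ 0` (else `441 = 448`). [folklore] -/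
theorem epsilon_ne_zero_of_sq (ht : t ^ 2 = 7) (h7 : (7 : F) ≠ 0) :
    21 + 8 * t ≠ 0 ∧ 21 - 8 * t ≠ 0 := by
  have hprod : (21 + 8 * t) * (21 - 8 * t) = -7 := by linear_combination (-64) * ht
  constructor
  · intro h
    rw [h, zero_mul] at hprod
    exact h7 (by linear_combination hprod)
  · intro h
    rw [h, mul_zero] at hprod
    exact h7 (by linear_combination hprod)

/-- **Symbol coincidence.** With `s² = −7`, `t² = 7` and `2, 7 ≠ 0`: `x·(21 + 8t)` is a square iff
`x·2(s − 21)` is — the `S'`-symbol equals the `S`-symbol `σ(ℓ)`. [folklore] -/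
theorem isSquare_mul_epsilon_iff (hs : s ^ 2 = -7) (ht : t ^ 2 = 7) (h2 : (2 : F) ≠ 0)
    (h7 : (7 : F) ≠ 0) (x : F) : IsSquare (x * (21 + 8 * t)) ↔ IsSquare (x * (2 * (s - 21))) := by
  refine isSquare_mul_iff_of_isSquare_mul (epsilon_ne_zero_of_sq ht h7).1
    (mul_ne_zero h2 (sub_ne_zero_and_add_ne_zero_of_sq hs h2 h7).1) ⟨t + s * (3 * t + 8), ?_⟩ x
  rw [← pow_two, sq_symbol_identity hs ht]; ring

/-! ## §3. Roots of the reduced quartics modulo `ℓ` -/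

/-- **Root criterion, `S`-side.** In a field with `2, 7 ≠ 0`, `s² = −7`, `7` a square: if
`x·y = 112 m²`, `y ≠ 0` and `2(s − 21)·m·y` is NOT a square, then `x + 21m·τ² + y·τ⁴` has no root `τ`
(a root `w = τ²` of `y w² + 21m w + x` is `w = m(−21 ± s)/(2y)`, and `(2yτ)² = 2y·m(−21 ± s)`; the two signs
differ by the square class of `(s − 21)(s + 21)·… = 7·□`). [cite: SilvermanAEC2009, Prop. X.4.9 and Example X.4.10] -/
theorem forall_quartic_ne_zero_of_not_isSquare (hs : s ^ 2 = -7) (h2 : (2 : F) ≠ 0) (h7 : (7 : F) ≠ 0)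
    (hsq7 : IsSquare (7 : F)) {m x y : F} (hm : m ≠ 0) (hy : y ≠ 0) (hxy : x * y = 112 * m ^ 2)
    (hns : ¬ IsSquare (2 * (s - 21) * m * y)) : ∀ τ : F, x + 21 * m * τ ^ 2 + y * τ ^ 4 ≠ 0 := by
  intro τ hτ
  obtain ⟨hs21, hs21'⟩ := sub_ne_zero_and_add_ne_zero_of_sq hs h2 h7
  -- complete the square: (2 y τ² + 21 m)² = (s m)²
  have hcs : (2 * y * τ ^ 2 + 21 * m) ^ 2 = (s * m) ^ 2 := by
    linear_combination (4 * y) * hτ - 4 * hxy - m ^ 2 * hs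
  rcases eq_or_eq_neg_of_sq_eq_sq _ _ hcs with h | h
  · -- 2yτ² + 21m = s m ⇒ (2yτ)² = 2(s − 21) m y
    exact hns ⟨2 * y * τ, by linear_combination (-(2 * y)) * h⟩
  · -- 2yτ² + 21m = −s m ⇒ (2yτ)² = −2(s + 21) m y; the two classes differ by 7·□
    have hsqA : IsSquare (-(2 * (s + 21) * m * y)) :=
      ⟨2 * y * τ, by linear_combination (-(2 * y)) * h⟩
    obtain ⟨r, hr⟩ := hsq7
    have hprod : IsSquare (-(2 * (s + 21) * m * y) * (2 * (s - 21) * m * y)) :=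
      ⟨16 * m * y * r, by linear_combination (-4 * m ^ 2 * y ^ 2) * hs + (256 * m ^ 2 * y ^ 2) * hr⟩
    have hne1 : -(2 * (s + 21) * m * y) ≠ 0 :=
      neg_ne_zero.mpr (mul_ne_zero (mul_ne_zero (mul_ne_zero h2 hs21') hm) hy)
    exact hns (by simpa using isSquare_mul_of_isSquare_mul (x := 1) hne1 hprod (by simpa using hsqA))

/-- **Root criterion, `S'`-side.** In a field with `7 ≠ 0`, `s² = −7`, `t² = 7`: if `x·y = −7 m²`,
`y ≠ 0` and `(21 + 8t)·m·y` is NOT a square, then `x − 42m·τ² + y·τ⁴` has no root (a root gives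
`(2yτ)² = 4y·m(21 ± 8t)`, and `(21 + 8t)(21 − 8t) = −7 = s²`). [cite: SilvermanAEC2009, Prop. X.4.9 and Example X.4.10] -/
theorem forall_quartic'_ne_zero_of_not_isSquare (hs : s ^ 2 = -7) (ht : t ^ 2 = 7) (h2 : (2 : F) ≠ 0)
    (h7 : (7 : F) ≠ 0) {m x y : F} (hm : m ≠ 0) (hy : y ≠ 0) (hxy : x * y = -7 * m ^ 2)
    (hns : ¬ IsSquare ((21 + 8 * t) * m * y)) : ∀ τ : F, x - 42 * m * τ ^ 2 + y * τ ^ 4 ≠ 0 := by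
  intro τ hτ
  obtain ⟨he, he'⟩ := epsilon_ne_zero_of_sq ht h7
  -- complete the square: (2 y τ² − 42 m)² = (16 m t)²
  have hcs : (2 * y * τ ^ 2 - 42 * m) ^ 2 = (16 * m * t) ^ 2 := by
    linear_combination (4 * y) * hτ - 4 * hxy - 256 * m ^ 2 * ht
  rcases eq_or_eq_neg_of_sq_eq_sq _ _ hcs with h | h
  · -- y τ² = m (21 + 8t) ⇒ (yτ)² = (21 + 8t) m y
    have h' : y * τ ^ 2 = m * (21 + 8 * t) := mul_left_cancel₀ h2 (by linear_combination h)
    exact hns ⟨y * τ, by linear_combination (-y) * h'⟩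
  · -- y τ² = m (21 − 8t); the two classes differ by (21 + 8t)(21 − 8t) = −7 = s²
    have h' : y * τ ^ 2 = m * (21 - 8 * t) := mul_left_cancel₀ h2 (by linear_combination h)
    have hsqA : IsSquare ((21 - 8 * t) * m * y) := ⟨y * τ, by linear_combination (-y) * h'⟩
    have hprod : IsSquare ((21 - 8 * t) * m * y * ((21 + 8 * t) * m * y)) :=
      ⟨s * m * y, by linear_combination (-(m ^ 2 * y ^ 2)) * hs - 64 * m ^ 2 * y ^ 2 * ht⟩
    have hne1 : (21 - 8 * t) * m * y ≠ 0 := mul_ne_zero (mul_ne_zero he' hm) hy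
    exact hns (by simpa using isSquare_mul_of_isSquare_mul (x := 1) hne1 hprod (by simpa using hsqA))

/-- If `v ≠ 0` is a square and `x` is not, then `x·v` is not a square. [folklore] -/
theorem not_isSquare_mul_of_isSquare_right {x v : F} (hv : v ≠ 0) (hsv : IsSquare v)
    (hx : ¬ IsSquare x) : ¬ IsSquare (x * v) := by
  intro h
  apply hx
  simpa using isSquare_mul_of_isSquare_mul (u := v) (v := 1) (x := x) hv (by simpa using hsv) h

/-- If `u ≠ 0` is a square and `u·y` is a square, then `y` is a square. [folklore] -/
theorem isSquare_of_isSquare_mul_of_isSquare {u y : F} (hu : u ≠ 0) (hsu : IsSquare u)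
    (h : IsSquare (u * y)) : IsSquare y := by
  simpa using isSquare_mul_of_isSquare_mul (u := u) (v := y) (x := 1) hu h (by simpa using hsu)

end Field

/-! ## §2. `ℓ`-adic insolubility from the absence of roots modulo `ℓ` -/

/-- In `ℤ_p`: `x mod p = 0 ↔ p ∣ x`. [folklore] -/
theorem padicInt_toZMod_eq_zero_iff_dvd {p : ℕ} [Fact p.Prime] (x : ℤ_[p]) :
    PadicInt.toZMod x = 0 ↔ (p : ℤ_[p]) ∣ x := by
  rw [← RingHom.mem_ker, PadicInt.ker_toZMod, PadicInt.maximalIdeal_eq_span_p,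
    Ideal.mem_span_singleton]

/-- One chart: `s² = p·(x + c t² + y t⁴)` in `ℤ_p` forces a root of `x + c τ² + y τ⁴` modulo `p`
(`p ∣ s`, divide by `p`, reduce). [folklore] -/
theorem exists_zmod_root_of_sq_eq_prime_mul_quartic {p : ℕ} [Fact p.Prime] {x c y : ℤ} {t s : ℤ_[p]}
    (h : s ^ 2 = (p : ℤ_[p]) * ((x : ℤ_[p]) + c * t ^ 2 + y * t ^ 4)) :
    ∃ τ : ZMod p, (x : ZMod p) + c * τ ^ 2 + y * τ ^ 4 = 0 := by
  have hpp : Prime (p : ℤ_[p]) := PadicInt.prime_p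
  have h0 := congrArg PadicInt.toZMod h
  simp only [map_pow, map_mul, map_natCast, ZMod.natCast_self, zero_mul] at h0
  have hs : (p : ℤ_[p]) ∣ s := (padicInt_toZMod_eq_zero_iff_dvd s).mp (pow_eq_zero_iff two_ne_zero |>.mp h0)
  obtain ⟨s₁, rfl⟩ := hs
  have h1 : (p : ℤ_[p]) * s₁ ^ 2 = (x : ℤ_[p]) + c * t ^ 2 + y * t ^ 4 :=
    mul_left_cancel₀ hpp.ne_zero (by rw [← h]; ring)
  have h2 := congrArg PadicInt.toZMod h1
  simp only [map_pow, map_add, map_mul, map_intCast, map_natCast, ZMod.natCast_self, zero_mul] at h2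
  exact ⟨PadicInt.toZMod t, h2.symm⟩

/-- **`ℓ`-adic insolubility lemma.** If `a = p c`, `d = p d₀`, `d' = p e₀` and neither
`d₀ + c τ² + e₀ τ⁴` nor `e₀ + c τ² + d₀ τ⁴` has a root modulo `p`, then `w² = d u⁴ + a u²z² + d' z⁴` has
no non-trivial `ℚ_p`-point (both `ℤ_p`-charts reduce to `exists_zmod_root_of_sq_eq_prime_mul_quartic`).
[cite: SilvermanAEC2009, Prop. X.4.9 and Example X.4.10] -/
theorem not_isSoluble_padic_of_forall_quartic_ne_zero {p : ℕ} [Fact p.Prime] {a d d' c d₀ e₀ : ℤ}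
    (ha : a = p * c) (hd : d = p * d₀) (hd' : d' = p * e₀)
    (h₁ : ∀ τ : ZMod p, (d₀ : ZMod p) + c * τ ^ 2 + e₀ * τ ^ 4 ≠ 0)
    (h₂ : ∀ τ : ZMod p, (e₀ : ZMod p) + c * τ ^ 2 + d₀ * τ ^ 4 ≠ 0) :
    ¬ ((twoIsogenyQuartic a d d').map (Int.castRingHom ℚ_[p])).IsSoluble := by
  intro h
  obtain ⟨e, e', hee, t, s, hs⟩ := exists_padicInt_of_isSoluble h
  rcases hee with ⟨rfl, rfl⟩ | ⟨rfl, rfl⟩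
  · obtain ⟨τ, hτ⟩ := exists_zmod_root_of_sq_eq_prime_mul_quartic (x := d₀) (c := c) (y := e₀) (t := t) (s := s)
      (by rw [hs, ha, hd, hd']; push_cast; ring)
    exact h₁ τ hτ
  · obtain ⟨τ, hτ⟩ := exists_zmod_root_of_sq_eq_prime_mul_quartic (x := e₀) (c := c) (y := d₀) (t := t) (s := s)
      (by rw [hs, ha, hd, hd']; push_cast; ring)
    exact h₂ τ hτ

/-! ## §4. The `ℓ`-classes of `S(ℓ m₀)` and `S'(ℓ m₀)` -/

section Assembly

variable {l : ℕ} [Fact l.Prime]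

/-- `ℓ ≠ 2` prime ⇒ `2 ≠ 0` in `𝔽_ℓ`. [folklore] -/
theorem zmod_two_ne_zero_of_prime_ne_two (hl2 : l ≠ 2) : (2 : ZMod l) ≠ 0 := by
  intro h
  have : ((2 : ℕ) : ZMod l) = 0 := by exact_mod_cast h
  rw [ZMod.natCast_eq_zero_iff] at this
  exact hl2 ((Nat.prime_dvd_prime_iff_eq Fact.out Nat.prime_two).mp this)

/-- `ℓ ≠ 7` prime ⇒ `7 ≠ 0` in `𝔽_ℓ`. [folklore] -/
theorem zmod_seven_ne_zero_of_prime_ne_seven (hl7 : l ≠ 7) : (7 : ZMod l) ≠ 0 := by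
  intro h
  have : ((7 : ℕ) : ZMod l) = 0 := by exact_mod_cast h
  rw [ZMod.natCast_eq_zero_iff] at this
  exact hl7 ((Nat.prime_dvd_prime_iff_eq Fact.out (by norm_num)).mp this)

/-- `ℓ ≠ 7` prime ⇒ `ℓ ∤ 7` in `ℤ`. [folklore] -/
theorem natCast_int_not_dvd_seven_of_prime_ne_seven (hl7 : l ≠ 7) : ¬ (l : ℤ) ∣ 7 := by
  intro h
  have h' : l ∣ 7 := by exact_mod_cast h
  exact hl7 ((Nat.prime_dvd_prime_iff_eq Fact.out (by norm_num)).mp h')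

/-- `ℓ ∉ {2, 7}` prime ⇒ `ℓ ∤ 112 = 2⁴·7` in `ℤ`. [folklore] -/
theorem natCast_int_not_dvd_onehundredtwelve (hl2 : l ≠ 2) (hl7 : l ≠ 7) : ¬ (l : ℤ) ∣ 112 := by
  intro h
  have hl : l.Prime := Fact.out
  have h' : l ∣ 2 ^ 4 * 7 := by exact_mod_cast h
  rcases (Nat.Prime.dvd_mul hl).mp h' with h2 | h7
  · exact hl2 ((Nat.prime_dvd_prime_iff_eq hl Nat.prime_two).mp (hl.dvd_of_dvd_pow h2))
  · exact natCast_int_not_dvd_seven_of_prime_ne_seven hl7 (by exact_mod_cast h7)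


/-- `l ∤ n` ⇒ `(n : 𝔽_ℓ) ≠ 0`. [folklore] -/
theorem intCast_zmod_ne_zero_of_prime_not_dvd {n : ℤ} (h : ¬ (l : ℤ) ∣ n) : (n : ZMod l) ≠ 0 := by
  rwa [Ne, ZMod.intCast_zmod_eq_zero_iff_dvd]

/-- From `d₀ e₀ = k m₀²` with `l ∤ k`, `l ∤ m₀`: `l ∤ d₀` and `l ∤ e₀`. [folklore] -/
theorem not_dvd_factors_of_mul_eq_mul_sq {d₀ e₀ k m₀ : ℤ} (he : d₀ * e₀ = k * m₀ ^ 2) (hk : ¬ (l : ℤ) ∣ k)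
    (hm : ¬ (l : ℤ) ∣ m₀) : ¬ (l : ℤ) ∣ d₀ ∧ ¬ (l : ℤ) ∣ e₀ := by
  have hl : Prime (l : ℤ) := Nat.prime_iff_prime_int.mp Fact.out
  have hprod : ¬ (l : ℤ) ∣ d₀ * e₀ := by
    rw [he]; intro h
    rcases hl.dvd_or_dvd h with h | h
    · exact hk h
    · exact hm (hl.dvd_of_dvd_pow h)
  exact ⟨fun h => hprod (dvd_mul_of_dvd_left h _), fun h => hprod (dvd_mul_of_dvd_right h _)⟩

/-- **`S`-side `ℓ`-class exclusion.** `ℓ ∉ {2, 7}` prime, `s² = −7` in `𝔽_ℓ`, `7 ∈ 𝔽_ℓ²`; `ℓ ∤ m₀`,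
`d₀ e₀ = 112 m₀²`. If `2(s − 21)·m₀·e₀` is not a square mod `ℓ`, then the class `ℓ d₀` is NOT in
`S(ℓ m₀) = twoIsogenySelmerGroup (21 ℓ m₀) (112 (ℓ m₀)²)`: its homogeneous space has no `ℚ_ℓ`-point.
[cite: SilvermanAEC2009, Prop. X.4.9 and Example X.4.10] -/
theorem ell_mul_not_mem_twoIsogenySelmerGroup_of_not_isSquare (hl2 : l ≠ 2) (hl7 : l ≠ 7)
    {s : ZMod l} (hs : s ^ 2 = -7) (hsq7 : IsSquare (7 : ZMod l)) {m₀ d₀ e₀ : ℤ} (hm : ¬ (l : ℤ) ∣ m₀)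
    (he : d₀ * e₀ = 112 * m₀ ^ 2) (hns : ¬ IsSquare (2 * (s - 21) * (m₀ : ZMod l) * (e₀ : ZMod l))) :
    (l : ℤ) * d₀ ∉ twoIsogenySelmerGroup (21 * ((l : ℤ) * m₀)) (112 * ((l : ℤ) * m₀) ^ 2) := by
  have hl : l.Prime := Fact.out
  have hl0 : (l : ℤ) ≠ 0 := by exact_mod_cast hl.ne_zero
  have h2F : (2 : ZMod l) ≠ 0 := zmod_two_ne_zero_of_prime_ne_two hl2
  have h7F : (7 : ZMod l) ≠ 0 := zmod_seven_ne_zero_of_prime_ne_seven hl7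
  have h112 : ¬ (l : ℤ) ∣ 112 := natCast_int_not_dvd_onehundredtwelve hl2 hl7
  obtain ⟨hd₀, he₀⟩ := not_dvd_factors_of_mul_eq_mul_sq he h112 hm
  have hmF : (m₀ : ZMod l) ≠ 0 := intCast_zmod_ne_zero_of_prime_not_dvd hm
  have hdF : (d₀ : ZMod l) ≠ 0 := intCast_zmod_ne_zero_of_prime_not_dvd hd₀
  have heF : (e₀ : ZMod l) ≠ 0 := intCast_zmod_ne_zero_of_prime_not_dvd he₀
  have hxy : (d₀ : ZMod l) * e₀ = 112 * (m₀ : ZMod l) ^ 2 := by exact_mod_cast congrArg (Int.cast : ℤ → ZMod l) he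
  -- the symbol for `d₀` equals the symbol for `e₀` (their product is `112 m₀² = 7·(4m₀)²`)
  have hns' : ¬ IsSquare (2 * (s - 21) * (m₀ : ZMod l) * (d₀ : ZMod l)) := by
    have hde : IsSquare ((e₀ : ZMod l) * d₀) := by
      obtain ⟨r, hr⟩ := hsq7
      exact ⟨4 * m₀ * r, by linear_combination hxy + 16 * m₀ ^ 2 * hr⟩
    rwa [← isSquare_mul_iff_of_isSquare_mul heF hdF hde]
  intro hmem
  have hb : (112 * ((l : ℤ) * m₀) ^ 2 : ℤ) ≠ 0 := by
    refine mul_ne_zero (by norm_num) (pow_ne_zero _ (mul_ne_zero hl0 ?_))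
    rintro rfl; exact hm (dvd_zero _)
  rw [mem_twoIsogenySelmerGroup_iff hb] at hmem
  obtain ⟨hsqf, -, -, hpadic⟩ := hmem
  have hdiv : (112 * ((l : ℤ) * m₀) ^ 2) / ((l : ℤ) * d₀) = (l : ℤ) * e₀ := by
    rw [show (112 * ((l : ℤ) * m₀) ^ 2 : ℤ) = ((l : ℤ) * d₀) * ((l : ℤ) * e₀) by
      linear_combination (-((l : ℤ) ^ 2)) * he]
    exact Int.mul_ediv_cancel_left _ hsqf.ne_zero
  rw [hdiv] at hpadic
  have key := not_isSoluble_padic_of_forall_quartic_ne_zero (p := l) (a := 21 * ((l : ℤ) * m₀))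
    (d := (l : ℤ) * d₀) (d' := (l : ℤ) * e₀) (c := 21 * m₀) (d₀ := d₀) (e₀ := e₀) (by ring) rfl rfl
    (fun τ => by
      push_cast
      exact forall_quartic_ne_zero_of_not_isSquare hs h2F h7F hsq7 hmF heF hxy hns τ)
    (fun τ => by
      push_cast
      exact forall_quartic_ne_zero_of_not_isSquare hs h2F h7F hsq7 hmF hdF (by rw [mul_comm]; exact hxy)
        hns' τ)
  exact key (hpadic l)

/-- **`S'`-side `ℓ`-class exclusion.** `ℓ ∉ {2, 7}` prime, `s² = −7`, `t² = 7` in `𝔽_ℓ`; `ℓ ∤ m₀`,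
`d₀ e₀ = −7 m₀²`. If `2(s − 21)·m₀·e₀` is not a square mod `ℓ` (equivalently `(21 + 8t) m₀ e₀`, §1), then the
class `ℓ d₀` is NOT in `S'(ℓ m₀) = twoIsogenySelmerGroup (−42 ℓ m₀) (−7 (ℓ m₀)²)`.
[cite: SilvermanAEC2009, Prop. X.4.9 and Example X.4.10] -/
theorem ell_mul_not_mem_twoIsogenySelmerGroup'_of_not_isSquare (hl2 : l ≠ 2) (hl7 : l ≠ 7)
    {s t : ZMod l} (hs : s ^ 2 = -7) (ht : t ^ 2 = 7) {m₀ d₀ e₀ : ℤ} (hm : ¬ (l : ℤ) ∣ m₀)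
    (he : d₀ * e₀ = -7 * m₀ ^ 2) (hns : ¬ IsSquare (2 * (s - 21) * (m₀ : ZMod l) * (e₀ : ZMod l))) :
    (l : ℤ) * d₀ ∉ twoIsogenySelmerGroup (-42 * ((l : ℤ) * m₀)) (-7 * ((l : ℤ) * m₀) ^ 2) := by
  have hl : l.Prime := Fact.out
  have hl0 : (l : ℤ) ≠ 0 := by exact_mod_cast hl.ne_zero
  have h2F : (2 : ZMod l) ≠ 0 := zmod_two_ne_zero_of_prime_ne_two hl2
  have h7F : (7 : ZMod l) ≠ 0 := zmod_seven_ne_zero_of_prime_ne_seven hl7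
  have h7 : ¬ (l : ℤ) ∣ -7 := fun h => natCast_int_not_dvd_seven_of_prime_ne_seven hl7 (dvd_neg.mp h)
  obtain ⟨hd₀, he₀⟩ := not_dvd_factors_of_mul_eq_mul_sq he h7 hm
  have hmF : (m₀ : ZMod l) ≠ 0 := intCast_zmod_ne_zero_of_prime_not_dvd hm
  have hdF : (d₀ : ZMod l) ≠ 0 := intCast_zmod_ne_zero_of_prime_not_dvd hd₀
  have heF : (e₀ : ZMod l) ≠ 0 := intCast_zmod_ne_zero_of_prime_not_dvd he₀
  have hxy : (d₀ : ZMod l) * e₀ = -7 * (m₀ : ZMod l) ^ 2 := by exact_mod_cast congrArg (Int.cast : ℤ → ZMod l) he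
  -- convert the hypothesis to the `(21 + 8t)`-symbol, for `e₀` and for `d₀`
  have hnsE : ¬ IsSquare ((21 + 8 * t) * (m₀ : ZMod l) * (e₀ : ZMod l)) := by
    rw [show (21 + 8 * t) * (m₀ : ZMod l) * (e₀ : ZMod l) = (m₀ : ZMod l) * e₀ * (21 + 8 * t) by ring,
      isSquare_mul_epsilon_iff hs ht h2F h7F]
    simpa [mul_comm, mul_assoc, mul_left_comm] using hns
  have hnsD : ¬ IsSquare ((21 + 8 * t) * (m₀ : ZMod l) * (d₀ : ZMod l)) := by
    have hde : IsSquare ((e₀ : ZMod l) * d₀) := ⟨s * m₀, by linear_combination hxy - m₀ ^ 2 * hs⟩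
    have := (isSquare_mul_iff_of_isSquare_mul heF hdF hde ((21 + 8 * t) * (m₀ : ZMod l))).not.mp hnsE
    simpa [mul_assoc] using this
  intro hmem
  have hb : (-7 * ((l : ℤ) * m₀) ^ 2 : ℤ) ≠ 0 := by
    refine mul_ne_zero (by norm_num) (pow_ne_zero _ (mul_ne_zero hl0 ?_))
    rintro rfl; exact hm (dvd_zero _)
  rw [mem_twoIsogenySelmerGroup_iff hb] at hmem
  obtain ⟨hsqf, -, -, hpadic⟩ := hmem
  have hdiv : (-7 * ((l : ℤ) * m₀) ^ 2) / ((l : ℤ) * d₀) = (l : ℤ) * e₀ := by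
    rw [show (-7 * ((l : ℤ) * m₀) ^ 2 : ℤ) = ((l : ℤ) * d₀) * ((l : ℤ) * e₀) by
      linear_combination (-((l : ℤ) ^ 2)) * he]
    exact Int.mul_ediv_cancel_left _ hsqf.ne_zero
  rw [hdiv] at hpadic
  have key := not_isSoluble_padic_of_forall_quartic_ne_zero (p := l) (a := -42 * ((l : ℤ) * m₀))
    (d := (l : ℤ) * d₀) (d' := (l : ℤ) * e₀) (c := -42 * m₀) (d₀ := d₀) (e₀ := e₀) (by ring) rfl rfl
    (fun τ h0 => by
      push_cast at h0
      exact forall_quartic'_ne_zero_of_not_isSquare hs ht h2F h7F hmF heF hxy hnsE τ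
        (by linear_combination h0))
    (fun τ h0 => by
      push_cast at h0
      exact forall_quartic'_ne_zero_of_not_isSquare hs ht h2F h7F hmF hdF (by rw [mul_comm]; exact hxy)
        hnsD τ (by linear_combination h0))
  exact key (hpadic l)

end Assembly

end Summit.BirchSwinnertonDyer.BirchSwinnertonDyer.Theorems.GoldfeldGoodTwists

end
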